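import Summits.CriticalPhenomena.PercolationContinuityZ3.Theorems.PercNearOneGluingNoHeavyLowerTailSahiTransportAndLast

/-!
# `NoHeavyLowerTail` (crux stmt-CriticalPhenomena-4575), Sahi / Kahn positivity: TRANSPORT CERTIFICATES (V-c) —
# adjoining a coordinate DISJUNCTIVELY preserves certificates; every CASCADE event is certified; Kahn's Conjecture 5 for cascade slots

Support file (cell `prim-l12`, seat P3, gen 7; `--supports stmt-CriticalPhenomena-4575`).  No `sorry`, no named facts, standard axioms.
New mathematics (this programme).

* `transportCert_orLast` — if `Π` certifies the up-set `H_k` at `q|_{Fin k}` then the division-free kernel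
  `Π∨((S,0),(T,0)) = q̄² Π(S,T)`, `Π∨((S,0),(S,1)) = p q̄ w'(S)·[S ∉ H_k]` certifies `H_k ∨ x_k` at `q`; its transport condition at a
  pair of up-sets with sections `X₀ ⊆ X₁`, `Z₀ ⊆ Z₁` is the nonnegative combination
  `tcRHS − LHS = q̄²·[(TC) of Π at (X₀,Z₀)] + p q̄·[μ'(H X₀ Z₁) − μ'(H X₀)μ'Z₁] + p q̄·[μ'(H X₁ Z₀) − μ'X₁ μ'(H Z₀)]
     + p q̄·[μ'(H X₁Z₁) − μ'(H X₀Z₁) − μ'(H X₁Z₀) + μ'(H X₀Z₀)] + p(1 − θ'q̄)·[μ'(X₁Z₁) − μ'X₁ μ'Z₁] + (1−θ') p q̄²·(μ'X₁ − μ'X₀)(μ'Z₁ − μ'Z₀)`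
  (`H = H_k`; Harris with and without `H_k`, a mixed second difference, monotonicity) — found by exact LP, verified symbolically;
* `cascade k b w` — the CASCADE events (monotone nested canalyzing / unate-cascade functions `((x₀ ∘₀ x₁) ∘₁ x₂) ⋯`, `∘ᵢ ∈ {∧,∨}`):
  cylinders, hitting events, `(a ∨ b) ∧ c`, `(a ∧ b) ∨ c`, `((a ∨ b) ∧ c) ∨ d`, … — an infinite family of every size
  (`6` of the `8` types on three coordinates; not majority, not `(a ∨ b) ∧ (c ∨ d)`);
* **`transportCert_cascade`** — every cascade carries a transport certificate at EVERY parameter vector (the transport-certificate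
  conjecture on this class), hence **`sahiE_three_nonneg_of_cascade` / `sahiE3_nonneg_of_cascade`**: KAHN'S CONJECTURE 5 / SAHI'S `C₃`
  `E₃(1_H, 1_U, 1_V) ≥ 0` whenever the first slot is a cascade junta, for ALL increasing `U, V`, every dimension, every `p`.
This reproves the hitting-slot theorem (`…SahiHittingSlot`) and the `a ∨ bc`, `(a ∨ b)c` certificates structurally and adds infinitely
many new first slots.  Census behind the rules (seat, exact LP over all vertex certificates, `k ≤ 5`): the binary AND/OR product rules
also hold numerically but are NOT linear consequences of the factor certificates (seat memo); the one-coordinate rules are. [this work]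
-/

noncomputable section

open scoped Classical

namespace Summit.CriticalPhenomena.PercolationContinuityZ3.Theorems

namespace SahiTransportCert

open Finset
open SahiHittingSlot
open Literature.Combinatorics.Sahi2008
open Literature.Probability.Percolation.BHK2006 (weight)
open Literature.Probability.Percolation.DecisionTree (ind ind_of_mem ind_of_not_mem ind_nonneg)

variable {k : ℕ}

/-! ### Adjoining the last coordinate disjunctively: `H_k ∨ x_k` -/

section OrLast

variable (q : Fin (k + 1) → unitInterval) (Hk : Set (Set (Fin k))) (Kr : Set (Fin k) → Set (Fin k) → ℝ)

/-- `H_k ∨ x_k ⊆ 2^{Fin (k+1)}`: the `Fin k`-part lies in `H_k` OR the last coordinate is open. [this work] -/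
def orLast : Set (Set (Fin (k + 1))) := {S | rest S ∈ Hk ∨ Fin.last k ∈ S}

omit q Kr in
/-- `orLast` of an up-set is an up-set. [this work] -/
theorem isUpperSet_orLast (h : IsUpperSet Hk) : IsUpperSet (orLast Hk) :=
  fun _ _ hle hS => hS.elim (fun h1 => Or.inl (h (Set.preimage_mono hle) h1)) fun h2 => Or.inr (hle h2)

omit q Kr in
/-- The closed section of `H_k ∨ x_k` is `H_k`. [this work] -/
@[simp] theorem sec0_orLast : sec0 (orLast Hk) = Hk := by
  ext S; simp [orLast]

omit q Kr in
/-- The open section of `H_k ∨ x_k` is everything. [this work] -/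
@[simp] theorem sec1_orLast : sec1 (orLast Hk) = Set.univ :=
  Set.eq_univ_of_forall fun S => Or.inr (last_mem_hi S)

omit Kr in
/-- `μ(H_k ∨ x_k) = (1 − p)·μ'(H_k) + p`. [this work] -/
theorem pr_orLast : pr q (orLast Hk) = (1 - plast q) * pr (qinit q) Hk + plast q := by
  rw [pr_eq_sec, sec0_orLast, sec1_orLast, pr_univ]; ring

/-- The kernel for `H_k ∨ x_k` (division-free): `Π∨((S,0),(T,0)) = q̄² Π(S,T)`, `Π∨((S,0),(S,1)) = p q̄ w'(S)[S ∉ H_k]`,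
all other entries `0`. [this work] -/
def krOr (S T : Set (Fin (k + 1))) : ℝ :=
  if Fin.last k ∈ S then 0
  else if Fin.last k ∈ T then
    (if rest T = rest S ∧ rest S ∉ Hk then plast q * (1 - plast q) * bernoulliWeight (qinit q) (rest S) else 0)
  else (1 - plast q) ^ 2 * Kr (rest S) (rest T)

/-- Kernel values on lifted patterns. [this work] -/
@[simp] theorem krOr_hi (S : Set (Fin k)) (T : Set (Fin (k + 1))) : krOr q Hk Kr (hi S) T = 0 := by simp [krOr]

/-- Kernel values on lifted patterns. [this work] -/
@[simp] theorem krOr_lo_lo (S T : Set (Fin k)) : krOr q Hk Kr (lo S) (lo T) = (1 - plast q) ^ 2 * Kr S T := by simp [krOr]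

/-- Kernel values on lifted patterns. [this work] -/
@[simp] theorem krOr_lo_hi (S T : Set (Fin k)) : krOr q Hk Kr (lo S) (hi T) =
    (if T = S ∧ S ∉ Hk then plast q * (1 - plast q) * bernoulliWeight (qinit q) S else 0) := by
  simp [krOr]

/-- **ADJOINING A COORDINATE BY `∨` PRESERVES CERTIFICATES**: if `Π` is a transport certificate for the up-set `H_k` at `q|_{Fin k}`,
then `Π∨` is one for `H_k ∨ x_k` at `q`. [this work] -/
theorem transportCert_orLast (hH : IsUpperSet Hk) (h : TransportCert (qinit q) Hk Kr) : TransportCert q (orLast Hk) (krOr q Hk Kr) := by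
  have hp0 : 0 ≤ plast q := plast_nonneg q
  have hp1 : plast q ≤ 1 := plast_le_one q
  have hθ'0 : 0 ≤ pr (qinit q) Hk := pr_nonneg _ Hk
  have hθ'1 : pr (qinit q) Hk ≤ 1 := pr_le_one _ Hk
  have hθ : pr q (orLast Hk) = (1 - plast q) * pr (qinit q) Hk + plast q := pr_orLast q Hk
  refine ⟨?_, ?_, ?_, ?_, ?_, ?_, ?_⟩
  · -- nonnegativity
    intro S T
    unfold krOr
    split_ifs
    · exact le_rfl
    · exact mul_nonneg (mul_nonneg hp0 (by linarith)) (bw_nonneg _ _)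
    · exact le_rfl
    · exact mul_nonneg (sq_nonneg _) (h.nonneg _ _)
  · -- upward
    refine pattern_cases (fun S => pattern_cases (fun T hne => ?_) (fun T hne => ?_)) (fun S T hne => ?_)
    · rw [krOr_lo_lo] at hne
      exact lo_subset_lo.2 (h.subset S T (right_ne_zero_of_mul hne))
    · rw [krOr_lo_hi] at hne
      by_cases hc : T = S ∧ S ∉ Hk
      · exact hc.1 ▸ lo_subset_hi_self S
      · rw [if_neg hc] at hne; exact (hne rfl).elim
    · simp at hne
  · -- sources outside
    refine pattern_cases (fun S => pattern_cases (fun T hne hS => ?_) (fun T hne hS => ?_)) (fun S T hne => ?_)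
    · rw [krOr_lo_lo] at hne
      rcases hS with hS | hS
      · exact h.offH S T (right_ne_zero_of_mul hne) (by simpa using hS)
      · exact last_not_mem_lo S hS
    · rw [krOr_lo_hi] at hne
      by_cases hc : T = S ∧ S ∉ Hk
      · rcases hS with hS | hS
        · exact hc.2 (by simpa using hS)
        · exact last_not_mem_lo S hS
      · rw [if_neg hc] at hne; exact (hne rfl).elim
    · simp at hne
  · -- targets inside
    refine pattern_cases (fun S => pattern_cases (fun T hne => ?_) (fun T hne => ?_)) (fun S T hne => ?_)
    · rw [krOr_lo_lo] at hne
      exact Or.inl (by rw [rest_lo]; exact h.memH S T (right_ne_zero_of_mul hne))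
    · exact Or.inr (last_mem_hi T)
    · simp at hne
  · -- row sums
    refine pattern_cases (fun S hS => ?_) (fun S hS => ?_)
    · have hS' : S ∉ Hk := fun h' => hS (Or.inl (by rwa [rest_lo]))
      rw [sum_set_succ, hθ, bw_lo]
      simp only [krOr_lo_lo, krOr_lo_hi, sum_add_distrib, ← mul_sum, sum_ite_eq_and, h.row S hS', hS', not_false_eq_true, if_true]
      ring
    · exact (hS (Or.inr (last_mem_hi S))).elim
  · -- column sums
    refine pattern_cases (fun T => ?_) (fun T => ?_)
    · rw [sum_set_succ, hθ, bw_lo]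
      simp only [krOr_lo_lo, krOr_hi, add_zero, ← mul_sum]
      have hcol := h.col T
      have hw := bw_nonneg (qinit q) T
      have hsum0 : 0 ≤ ∑ S, Kr S T := sum_nonneg fun S _ => h.nonneg S T
      nlinarith [mul_le_mul_of_nonneg_left hcol (sq_nonneg (1 - plast q)), mul_nonneg hp0 hw, mul_nonneg hθ'0 hw,
        mul_nonneg (mul_nonneg hp0 (sub_nonneg.2 hp1)) hw, mul_nonneg (mul_nonneg hp0 (sub_nonneg.2 hp1)) (mul_nonneg hθ'0 hw)]
    · rw [sum_set_succ, hθ, bw_hi]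
      simp only [krOr_lo_hi, krOr_hi, add_zero]
      rw [sum_ite_eq_and' T (fun S => S ∉ Hk) (fun S => plast q * (1 - plast q) * bernoulliWeight (qinit q) S)]
      have hw := bw_nonneg (qinit q) T
      have hite : (if T ∉ Hk then plast q * (1 - plast q) * bernoulliWeight (qinit q) T else 0) ≤
          plast q * (1 - plast q) * bernoulliWeight (qinit q) T := by
        by_cases hT : T ∈ Hk
        · rw [if_neg (not_not.2 hT)]; exact mul_nonneg (mul_nonneg hp0 (sub_nonneg.2 hp1)) hw
        · rw [if_pos hT]
      nlinarith [mul_nonneg hp0 hw, mul_nonneg (mul_nonneg hp0 hp0) hw, mul_nonneg (mul_nonneg hp0 (sub_nonneg.2 hp1)) (mul_nonneg (sub_nonneg.2 hθ'1) hw)]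
  · -- the transport condition
    intro 𝒳 𝒵 h𝒳 h𝒵
    have hX₀ : IsUpperSet (sec0 𝒳) := isUpperSet_sec0 h𝒳
    have hZ₀ : IsUpperSet (sec0 𝒵) := isUpperSet_sec0 h𝒵
    have hX₁ : IsUpperSet (sec1 𝒳) := isUpperSet_sec1 h𝒳
    have hZ₁ : IsUpperSet (sec1 𝒵) := isUpperSet_sec1 h𝒵
    have hX01 : sec0 𝒳 ⊆ sec1 𝒳 := sec0_subset_sec1 h𝒳
    have hZ01 : sec0 𝒵 ⊆ sec1 𝒵 := sec0_subset_sec1 h𝒵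
    -- the left-hand side through the sections
    have inner : ∀ S : Set (Fin k), ∑ T, krOr q Hk Kr (lo S) T * ind (𝒳 ∩ 𝒵) T =
        (1 - plast q) ^ 2 * ∑ T : Set (Fin k), Kr S T * ind (sec0 𝒳 ∩ sec0 𝒵) T +
          plast q * (1 - plast q) * (bernoulliWeight (qinit q) S * ind Hkᶜ S * ind (sec1 𝒳 ∩ sec1 𝒵) S) := by
      intro S
      rw [sum_set_succ, sum_add_distrib]
      congr 1
      · rw [mul_sum]
        exact sum_congr rfl fun T _ => by rw [krOr_lo_lo, ind_lo, sec0_inter]; ring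
      · have : ∀ T : Set (Fin k), krOr q Hk Kr (lo S) (hi T) * ind (𝒳 ∩ 𝒵) (hi T) =
            if T = S then plast q * (1 - plast q) * (bernoulliWeight (qinit q) S * ind Hkᶜ S * ind (sec1 𝒳 ∩ sec1 𝒵) S) else 0 := by
          intro T
          rw [krOr_lo_hi, ind_hi, sec1_inter]
          by_cases hT : T = S
          · subst hT
            by_cases hc : T ∈ Hk
            · simp [hc, ind_of_not_mem (show T ∉ Hkᶜ from fun h' => h' hc)]
            · simp [hc, ind_of_mem (show T ∈ Hkᶜ from hc)]; ring
          · simp [hT]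
        simp_rw [this]
        rw [Finset.sum_ite_eq' Finset.univ S, if_pos (mem_univ S)]
    have hL : ∑ S, ∑ T, krOr q Hk Kr S T * ind (𝒳 ∩ 𝒵) T =
        (1 - plast q) ^ 2 * ∑ S, ∑ T, Kr S T * ind (sec0 𝒳 ∩ sec0 𝒵) T +
          plast q * (1 - plast q) * pr (qinit q) (Hkᶜ ∩ (sec1 𝒳 ∩ sec1 𝒵)) := by
      rw [sum_set_succ]
      simp only [inner, krOr_hi, zero_mul, sum_const_zero, add_zero]
      rw [pr_inter_eq_sum, Finset.mul_sum, Finset.mul_sum, ← Finset.sum_add_distrib]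
    -- the right-hand side through the sections
    have eXZ : pr q (𝒳 ∩ 𝒵) = (1 - plast q) * pr (qinit q) (sec0 𝒳 ∩ sec0 𝒵) + plast q * pr (qinit q) (sec1 𝒳 ∩ sec1 𝒵) := by
      rw [pr_eq_sec, sec0_inter, sec1_inter]
    have eX : pr q 𝒳 = (1 - plast q) * pr (qinit q) (sec0 𝒳) + plast q * pr (qinit q) (sec1 𝒳) := pr_eq_sec q 𝒳
    have eZ : pr q 𝒵 = (1 - plast q) * pr (qinit q) (sec0 𝒵) + plast q * pr (qinit q) (sec1 𝒵) := pr_eq_sec q 𝒵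
    have eHXZ : pr q ((orLast Hk)ᶜ ∩ (𝒳 ∩ 𝒵)) =
        (1 - plast q) * (pr (qinit q) (sec0 𝒳 ∩ sec0 𝒵) - pr (qinit q) (Hk ∩ (sec0 𝒳 ∩ sec0 𝒵))) := by
      rw [pr_eq_sec, sec0_inter, sec1_inter, sec0_compl, sec1_compl, sec0_orLast, sec1_orLast, sec0_inter, sec1_inter,
        Set.compl_univ, Set.empty_inter, pr_empty, pr_compl_inter]; ring
    have eHX : pr q ((orLast Hk)ᶜ ∩ 𝒳) = (1 - plast q) * (pr (qinit q) (sec0 𝒳) - pr (qinit q) (Hk ∩ sec0 𝒳)) := by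
      rw [pr_eq_sec, sec0_inter, sec1_inter, sec0_compl, sec1_compl, sec0_orLast, sec1_orLast, Set.compl_univ, Set.empty_inter,
        pr_empty, pr_compl_inter]; ring
    have eHZ : pr q ((orLast Hk)ᶜ ∩ 𝒵) = (1 - plast q) * (pr (qinit q) (sec0 𝒵) - pr (qinit q) (Hk ∩ sec0 𝒵)) := by
      rw [pr_eq_sec, sec0_inter, sec1_inter, sec0_compl, sec1_compl, sec0_orLast, sec1_orLast, Set.compl_univ, Set.empty_inter,
        pr_empty, pr_compl_inter]; ring
    have eL2 : pr (qinit q) (Hkᶜ ∩ (sec1 𝒳 ∩ sec1 𝒵)) = pr (qinit q) (sec1 𝒳 ∩ sec1 𝒵) - pr (qinit q) (Hk ∩ (sec1 𝒳 ∩ sec1 𝒵)) :=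
      pr_compl_inter _ Hk _
    -- the ingredients on the `k`-cube
    have htc := h.tc (sec0 𝒳) (sec0 𝒵) hX₀ hZ₀
    rw [pr_compl_inter, pr_compl_inter, pr_compl_inter] at htc
    have hT1 : pr (qinit q) (Hk ∩ sec0 𝒳) * pr (qinit q) (sec1 𝒵) ≤ pr (qinit q) (Hk ∩ (sec0 𝒳 ∩ sec1 𝒵)) := by
      have := pr_mul_pr_le_pr_inter (qinit q) (hH.inter hX₀) hZ₁; rwa [Set.inter_assoc] at this
    have hT2 : pr (qinit q) (sec1 𝒳) * pr (qinit q) (Hk ∩ sec0 𝒵) ≤ pr (qinit q) (Hk ∩ (sec1 𝒳 ∩ sec0 𝒵)) := by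
      have := pr_mul_pr_le_pr_inter (qinit q) hX₁ (hH.inter hZ₀); rwa [Set.inter_left_comm] at this
    have hT3 := pr_inter_second_diff_nonneg (qinit q) Hk hX01 hZ01
    have hT4 : pr (qinit q) (sec1 𝒳) * pr (qinit q) (sec1 𝒵) ≤ pr (qinit q) (sec1 𝒳 ∩ sec1 𝒵) := pr_mul_pr_le_pr_inter _ hX₁ hZ₁
    have hmX : pr (qinit q) (sec0 𝒳) ≤ pr (qinit q) (sec1 𝒳) := pr_mono _ hX01
    have hmZ : pr (qinit q) (sec0 𝒵) ≤ pr (qinit q) (sec1 𝒵) := pr_mono _ hZ01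
    rw [hL, eL2, hθ, eXZ, eX, eZ, eHXZ, eHX, eHZ]
    nlinarith [mul_nonneg (sq_nonneg (1 - plast q)) (sub_nonneg.2 htc),
      mul_nonneg (mul_nonneg hp0 (sub_nonneg.2 hp1)) (sub_nonneg.2 hT1),
      mul_nonneg (mul_nonneg hp0 (sub_nonneg.2 hp1)) (sub_nonneg.2 hT2),
      mul_nonneg (mul_nonneg hp0 (sub_nonneg.2 hp1)) hT3,
      mul_nonneg (mul_nonneg hp0 (by nlinarith : (0:ℝ) ≤ 1 - pr (qinit q) Hk * (1 - plast q))) (sub_nonneg.2 hT4),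
      mul_nonneg (mul_nonneg (mul_nonneg (sub_nonneg.2 hθ'1) hp0) (sq_nonneg (1 - plast q))) (mul_nonneg (sub_nonneg.2 hmX) (sub_nonneg.2 hmZ))]

end OrLast

/-! ### Cascade events and Kahn's Conjecture 5 for cascade first slots -/

/-- **CASCADE pattern events** (monotone nested canalyzing / unate-cascade functions, read with the LAST coordinate outermost):
`cascade k b w` starts from the full family (`b = true`) or the empty family (`b = false`) of `2^{Fin 0}` and adjoins coordinate
`i` disjunctively if `w i = true` (`H ↦ H ∨ x_i`) and conjunctively if `w i = false` (`H ↦ H ∧ x_i`), for `i = 0, …, k−1` in turn.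
Examples: cylinders `x₀ ∧ ⋯ ∧ x_{k-1}`, hitting events `x₀ ∨ ⋯ ∨ x_{k-1}`, `(x₀ ∨ x₁) ∧ x₂`, `(x₀ ∧ x₁) ∨ x₂`,
`((x₀ ∨ x₁) ∧ x₂) ∨ x₃`, … [this work] -/
def cascade : ∀ (k : ℕ), Bool → (Fin k → Bool) → Set (Set (Fin k))
  | 0, b, _ => if b then Set.univ else ∅
  | k + 1, b, w =>
    if w (Fin.last k) then orLast (cascade k b fun i => w (Fin.castSucc i)) else andLast (cascade k b fun i => w (Fin.castSucc i))

/-- Cascades are up-sets. [this work] -/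
theorem isUpperSet_cascade : ∀ (k : ℕ) (b : Bool) (w : Fin k → Bool), IsUpperSet (cascade k b w)
  | 0, b, _ => by
    unfold cascade
    cases b
    · exact isUpperSet_empty
    · exact isUpperSet_univ
  | k + 1, b, w => by
    unfold cascade
    by_cases hw : w (Fin.last k) = true
    · rw [if_pos hw]; exact isUpperSet_orLast _ (isUpperSet_cascade k b _)
    · rw [if_neg hw]; exact isUpperSet_andLast _ (isUpperSet_cascade k b _)

/-- **EVERY CASCADE CARRIES A TRANSPORT CERTIFICATE AT EVERY PARAMETER VECTOR** — the transport-certificate conjecture holds on the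
class of cascade events, for every number of coordinates, with an explicit division-free kernel. [this work] -/
theorem transportCert_cascade : ∀ (k : ℕ) (b : Bool) (w : Fin k → Bool) (q : Fin k → unitInterval), ∃ Kr, TransportCert q (cascade k b w) Kr
  | 0, b, _, q => by
    unfold cascade
    cases b
    · exact ⟨_, transportCert_empty q⟩
    · exact ⟨_, transportCert_univ q⟩
  | k + 1, b, w, q => by
    obtain ⟨Kr, hKr⟩ := transportCert_cascade k b (fun i => w (Fin.castSucc i)) (qinit q)
    unfold cascade
    by_cases hw : w (Fin.last k) = true
    · rw [if_pos hw]; exact ⟨_, transportCert_orLast q _ Kr (isUpperSet_cascade k b _) hKr⟩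
    · rw [if_neg hw]; exact ⟨_, transportCert_andLast q _ Kr (isUpperSet_cascade k b _) hKr⟩

/-- **KAHN'S CONJECTURE 5 / SAHI'S `C₃` FOR A CASCADE FIRST SLOT.**  Let `H ⊆ 2^ι` be determined by the block `e : Fin k ↪ ι` and let
its pattern event be a cascade (coordinate `e i` adjoined by `∨` or `∧` according to `w i`; e.g. hitting events, cylinders,
`(a ∨ b) ∧ c`, `(a ∧ b) ∨ c`, `((a ∨ b) ∧ c) ∨ d`, of any length).  Then `E₃(1_H, 1_U, 1_V) ≥ 0` for ALL increasing events `U, V` of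
`2^ι` — every dimension, every parameter vector. [this work] -/
theorem sahiE_three_nonneg_of_cascade {ι : Type} [Fintype ι] (p : ι → unitInterval) {k : ℕ} (e : Fin k ↪ ι) {H : Set (Set ι)}
    (hH : Literature.Probability.Percolation.DeterminedBy H (Set.range e)) (b : Bool) (w : Fin k → Bool) (hc : pat e H = cascade k b w)
    {U V : Set (Set ι)} (hU : IsUpperSet U) (hV : IsUpperSet V) :
    0 ≤ sahiE (bernoulliWeight p) 3 ![ind H, ind U, ind V] := by
  obtain ⟨Kr, hKr⟩ := transportCert_cascade k b w (pk e p)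
  rw [← hc] at hKr
  exact sahiE_three_nonneg_of_transportCert p e hH hKr hU hV

/-- The same in the tree's event vocabulary: `0 ≤ sahiE3 (prodBernoulli p) H U V`. [this work] -/
theorem sahiE3_nonneg_of_cascade {ι : Type} [Fintype ι] (p : ι → unitInterval) {k : ℕ} (e : Fin k ↪ ι) {H : Set (Set ι)}
    (hH : Literature.Probability.Percolation.DeterminedBy H (Set.range e)) (b : Bool) (w : Fin k → Bool) (hc : pat e H = cascade k b w)
    {U V : Set (Set ι)} (hU : IsUpperSet U) (hV : IsUpperSet V) :
    0 ≤ Literature.Probability.LatticeModels.sahiE3 (Literature.Probability.LatticeModels.prodBernoulli p) H U V := by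
  rw [← sahiE_three_ind]
  exact sahiE_three_nonneg_of_cascade p e hH b w hc hU hV

/-! ### Cascades over an arbitrary certified base -/

/-- **Cascades over a base event**: start from ANY pattern event `P ⊆ 2^{Fin k₀}` and adjoin `j` fresh coordinates one at a time, the
`i`-th disjunctively if `w i = true` and conjunctively otherwise (`P ↦ P ∨ x`, `P ↦ P ∧ x`). [this work] -/
def cascadeOver {k₀ : ℕ} (P : Set (Set (Fin k₀))) : ∀ (j : ℕ), (Fin j → Bool) → Set (Set (Fin (k₀ + j)))
  | 0, _ => P
  | j + 1, w =>
    if w (Fin.last j) then orLast (cascadeOver P j fun i => w (Fin.castSucc i)) else andLast (cascadeOver P j fun i => w (Fin.castSucc i))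

/-- Cascades over an up-set are up-sets. [this work] -/
theorem isUpperSet_cascadeOver {k₀ : ℕ} {P : Set (Set (Fin k₀))} (hP : IsUpperSet P) :
    ∀ (j : ℕ) (w : Fin j → Bool), IsUpperSet (cascadeOver P j w)
  | 0, _ => hP
  | j + 1, w => by
    unfold cascadeOver
    by_cases hw : w (Fin.last j) = true
    · rw [if_pos hw]; exact isUpperSet_orLast _ (isUpperSet_cascadeOver hP j _)
    · rw [if_neg hw]; exact isUpperSet_andLast _ (isUpperSet_cascadeOver hP j _)

/-- **A base certified at every parameter vector stays certified under adjoining coordinates**: if the up-set `P ⊆ 2^{Fin k₀}` carries a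
transport certificate at every `q`, so does every cascade over `P`. [this work] -/
theorem transportCert_cascadeOver {k₀ : ℕ} {P : Set (Set (Fin k₀))} (hP : IsUpperSet P)
    (hcert : ∀ q : Fin k₀ → unitInterval, ∃ Kr, TransportCert q P Kr) :
    ∀ (j : ℕ) (w : Fin j → Bool) (q : Fin (k₀ + j) → unitInterval), ∃ Kr, TransportCert q (cascadeOver P j w) Kr
  | 0, _, q => hcert q
  | j + 1, w, q => by
    obtain ⟨Kr, hKr⟩ := transportCert_cascadeOver hP hcert j (fun i => w (Fin.castSucc i)) (qinit q)
    unfold cascadeOver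
    by_cases hw : w (Fin.last j) = true
    · rw [if_pos hw]; exact ⟨_, transportCert_orLast q _ Kr (isUpperSet_cascadeOver hP j _) hKr⟩
    · rw [if_neg hw]; exact ⟨_, transportCert_andLast q _ Kr (isUpperSet_cascadeOver hP j _) hKr⟩

/-- Kahn's Conjecture 5 / Sahi's `C₃` for a first slot that is a cascade over a base certified at every parameter vector. [this work] -/
theorem sahiE_three_nonneg_of_cascadeOver {ι : Type} [Fintype ι] (p : ι → unitInterval) {k₀ j : ℕ} (e : Fin (k₀ + j) ↪ ι) {H : Set (Set ι)}
    (hH : Literature.Probability.Percolation.DeterminedBy H (Set.range e)) {P : Set (Set (Fin k₀))} (hP : IsUpperSet P)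
    (hcert : ∀ q : Fin k₀ → unitInterval, ∃ Kr, TransportCert q P Kr) (w : Fin j → Bool) (hc : pat e H = cascadeOver P j w)
    {U V : Set (Set ι)} (hU : IsUpperSet U) (hV : IsUpperSet V) :
    0 ≤ sahiE (bernoulliWeight p) 3 ![ind H, ind U, ind V] := by
  obtain ⟨Kr, hKr⟩ := transportCert_cascadeOver hP hcert j w (pk e p)
  rw [← hc] at hKr
  exact sahiE_three_nonneg_of_transportCert p e hH hKr hU hV

end SahiTransportCert

end Summit.CriticalPhenomena.PercolationContinuityZ3.Theorems
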